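/-
Copyright (c) 2026 the pub-hodgecm-mathlib formalisation cell (harness21).  Prover seat hodgecm-mathlib-K2E1-p08 (g6), Track B ∕ K2-LIT
(build stream 29), h413 = `stmt-HodgeConjecture-24833`, line `K2_E1_TraceFormulaBeta`, campaign «EIS-R7-BL-SPH-2» (Bernstein–Lapid soft continuation of
the spherical Borel Eisenstein series of `U(1,1)`), file «P2a-ι» part 2 (`N = 2`); dealer K2E1-plan (g5) DEAL 2026-09-04T08:55:26Z (1).
-/
import Summits.HodgeConjecture.HodgeConjecture.Theorems.K2E1BLIotaUnfoldingU              -- ★ (this seat) part 1: the every-rank unfolding + measure letter (+ ★ leaf 1 ED. 2, ★ p858763 §1)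
import Summits.HodgeConjecture.HodgeConjecture.Theorems.K2E1BLIotaWeightBoundU2             -- ★ p858750 (this seat) BL-R1 part 3: `w₁^{−m} ≤ Σ_{S_c} H^{−m} ≤ C'·w₁^{−m}` + bridges
import HarnessLib

/-!
# h413 ∕ Track B «K2-LIT», campaign «EIS-R7-BL-SPH-2» — helper `K2E1BLIotaBoundU2` («P2a-ι», part 2, `N = 2`): THE PULL-BACK `ι_{c,k} : 𝓗_k(𝔛) → 𝓗_k(Z_c)` ALONG
# `p : Z_c → 𝔛` IS BOUNDED, BOUNDED BELOW AND QUASI-MEASURE-PRESERVING — the letters `IotaBound` ∕ `IsClosed (range ι)` ∕ `Injective ι` of Bernstein–Lapid's Claim 4 bullet 1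

Cell `pub/hodgecm-mathlib`, crux H413 = `stmt-HodgeConjecture-24833`, route of record `HCCMUnconditional`; chair K2-lead (g1), dealer K2E1-plan (g5) (DEAL «P2a-ι» 08:55:26Z);
spec of record = K2E1b-plan (g6) WIRING «EIS-R7-BL-SPH-2» `7d1cceb628a30de8` §3 P2a [BernsteinLapid2019, §4 Claim 4 bullet 1 (arXiv:1911.02342 p. 10): «for `0 < c ≤ c₀` the
pull-back via the surjective `p_c` defines a closed embedding `ι_{c,N} : 𝓗_N(𝔛) → 𝓗_N(Z_c)` of Banach spaces»].  THEOREMS ONLY (no `def`, no `instance`, no `notation`, no named-fact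
hypothesis, no `sorry`); lane `--kind proof --supports stmt-HodgeConjecture-24833 --as helper` (count-neutral).  Currency of ★ part 1 `K2E1BLIotaUnfoldingU` (`Z = borelQuotient`,
`p = pZX`, `wtm = weightedTruncMeasure`, the measure letter `hμZ` with its `B(F)♯`-weight `hβ`) and of ★ leaf 1 ED. 2 `K2E1BLBorelSpacesU2Defs` (`w₁ = supHeight`,
`𝓗_k(𝔛) = HX k μ = L²(μ.withDensity w₁^{−2k})`).  `N = 2` throughout (the fibre weights of ★ BL-R1 are rank one); §4 for the CM pair `L ∕ L⁺`.

* §3 (every quadratic `E ∕ F`) `tsum_truncWeight_eq_coe_sum` — the fibre series `Σ'_q 𝟙_{c<H(q̃y)} H(q̃ y)^{−2k}` of ★ part 1 IS the finite fibre sum `Σ_{q ∈ S_c(y)} H(q̃ y)^{−2k}` of ★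
  BL-R1 (★ `finite_setOf_lt_borelHeight_two`); `supHeight_eq_ciSup` (`w₁ x = ⨆_{γ ∈ G(F)} H(γ x̃⁻¹)`, ★ bridge `ciSup_borelHeight_toAdelic_mul_eq`); `supHeight_toAutomorphicQuotient`
  (`w₁ [g] = ⨆_γ H(γ g⁻¹)`); **`isOpen_setOf_lt_supHeight`** ∕ **`measurable_supHeight`** — `w₁` is LOWER SEMICONTINUOUS (`{a < w₁} = mk({g ∣ ∃ γ, a < H(γ g⁻¹)})`, ★
  `bddAbove_range_borelHeight_mul`, `QuotientGroup.isOpenMap_coe`), so the weight `w₁^{−2k}` of `𝓗_k(𝔛)` is Borel (no measurability letter).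
* §4 (CM pair) **`exists_forall_lintegral_comp_pZX_le_cm (hc : 0 < c) (k) : ∃ B ≠ ∞, ∀ F Borel, ∫⁻_Z F∘p d(wtm_{k,c}) ≤ B · ∫⁻_𝔛 F · w₁^{−2k} dμ`** (★ part 1 unfolding + ★
  `exists_sum_inv_pow_le_mul_ciSup_inv_pow_cm`) and **`exists_pos_forall_mul_lintegral_le_lintegral_comp_pZX_cm (k) : ∃ c₁ > 0, ∀ 0 < c < c₁, ∃ A ≠ 0, ∞, ∀ F Borel,
  A · ∫⁻_𝔛 F · w₁^{−2k} dμ ≤ ∫⁻_Z F∘p d(wtm_{k,c})`** (★ `exists_pos_forall_ciSup_inv_pow_le_sum_le_cm`); whence THE THREE LETTERS of leaf 2's `iota`∕`piN`: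
  **`quasiMeasurePreserving_pZX_cm`** (`IotaBound` (i): `μ.withDensity w₁^{−2k}`-null sets pull back to `wtm`-null sets), **`exists_eLpNorm_comp_pZX_le_cm`**
  (`IotaBound` (ii) with `iotaFun` unfolded: `‖u ∘ p‖_{L²(wtm)} ≤ C · ‖u‖_{𝓗_k(𝔛)}` for every `u ∈ 𝓗_k(𝔛)`, EVERY `c > 0`), **`exists_pos_forall_mul_eLpNorm_le_eLpNorm_comp_pZX_cm`**
  (`κ · ‖u‖ ≤ ‖u ∘ p‖`, `κ > 0`, for `0 < c < c₁`: `ι` is bounded below ⟹ injective with closed range — the `(hinj)(hcl)` letters of `piN`, a one-line wrapper once leaf 2 is ★).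

HONEST LABEL.  Count-neutral helper of the BL-SPH-2 template (consumer: leaf 2 `K2E1BLBorelOperatorsU2Defs` ∕ P2a, K2E4-p10); closes no socket; HC_CM is proved only modulo the 7
printed citations (2 remaining named inputs: hLiu418 = `stmt-HodgeConjecture-24832`, h413 = `stmt-HodgeConjecture-24833`) until rung 0 closes.

## References
* [BernsteinLapid2019] J. Bernstein, E. Lapid, *On the meromorphic continuation of Eisenstein series*, J. Amer. Math. Soc. 37 (2024) (arXiv:1911.02342), §4 Claim 4 (p. 10).
* [MoeglinWaldspurger1995] C. Mœglin, J.-L. Waldspurger, *Spectral Decomposition and Eisenstein Series* (1995), I.2.1–I.2.2, I.2.13.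
* [Borel1963] A. Borel, *Some finiteness properties of adele groups over number fields*, Publ. Math. IHÉS 16 (1963), §5.
-/

set_option autoImplicit false
-- the mandated namespace repeats `HodgeConjecture.HodgeConjecture`, as in every `Theorems/*.lean` of this sub-problem
set_option linter.dupNamespace false

noncomputable section

open MeasureTheory MeasureTheory.Measure Set NumberField IsDedekindDomain Filter Topology
open scoped NNReal ENNReal
open Literature.MeasureTheory.Group Literature.NumberTheory.Automorphic Literature.NumberTheory.Automorphic.UnitaryGroup AdelicGroupData
open Summit.HodgeConjecture.HodgeConjecture.Cruxes.H413.K2E1BLBorelSpacesU2Defs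
open Summit.HodgeConjecture.HodgeConjecture.Cruxes.H413.K2E1BLHeightCosetsU2
open Summit.HodgeConjecture.HodgeConjecture.Cruxes.H413.K2E1BLReductionCoveringU2
open Summit.HodgeConjecture.HodgeConjecture.Cruxes.H413.K2E1BLIotaWeightBoundU2
open Summit.HodgeConjecture.HodgeConjecture.Cruxes.H413.K2E1BLIotaUnfoldingU

namespace Summit.HodgeConjecture.HodgeConjecture.Cruxes.H413.K2E1BLIotaBoundU2

/-! ## §3 (`N = 2`) The fibre series is the finite fibre sum of BL-R1; `w₁` is lower semicontinuous, hence Borel -/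

section Generic

variable {F E : Type} [Field F] [NumberField F] [Field E] [NumberField E] [Algebra F E] {c : E ≃ₐ[F] E}

/-- **The fibre series is a finite sum**: `Σ'_{q ∈ B(F)∖G(F)} 𝟙_{c < H(q̃ y)} H(q̃ y)^{−2k} = Σ_{q ∈ S_c(y)} H(q̃ y)^{−2k}` (in `ℝ≥0∞`), `S_c(y) = {q ∣ c < H(q̃ y)}` finite by ★
`finite_setOf_lt_borelHeight_two`. [cite: BernsteinLapid2019, §4 (p. 9)] -/
theorem tsum_truncWeight_eq_coe_sum {c₀ : ℝ≥0} (hc : 0 < c₀) (k : ℕ) (y : (quasiSplit F E c 2).Adelic) :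
    (∑' q : Quotient (QuotientGroup.rightRel (arithmeticBorel F E c 2)),
        {y' : (quasiSplit F E c 2).Adelic | c₀ < borelHeight y'}.indicator (fun y' => (((borelHeight y')⁻¹ ^ (2 * k) : ℝ≥0) : ℝ≥0∞))
          (((q.out : (quasiSplit F E c 2).arithmeticSubgroup) : (quasiSplit F E c 2).Adelic) * y)) =
      ((∑ q ∈ (finite_setOf_lt_borelHeight_two y hc).toFinset,
        (borelHeight (((q.out : (quasiSplit F E c 2).arithmeticSubgroup) : (quasiSplit F E c 2).Adelic) * y))⁻¹ ^ (2 * k) : ℝ≥0) : ℝ≥0∞) := by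
  classical
  rw [tsum_eq_sum (s := (finite_setOf_lt_borelHeight_two y hc).toFinset) (fun q hq => ?_)]
  · rw [ENNReal.ofNNReal_finsetSum]
    refine Finset.sum_congr rfl fun q hq => ?_
    rw [Set.Finite.mem_toFinset] at hq
    have hq' : ((q.out : (quasiSplit F E c 2).arithmeticSubgroup) : (quasiSplit F E c 2).Adelic) * y ∈
        {y' : (quasiSplit F E c 2).Adelic | c₀ < borelHeight y'} := hq
    exact Set.indicator_of_mem hq' _
  · rw [Set.Finite.mem_toFinset] at hq
    have hq' : ((q.out : (quasiSplit F E c 2).arithmeticSubgroup) : (quasiSplit F E c 2).Adelic) * y ∉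
        {y' : (quasiSplit F E c 2).Adelic | c₀ < borelHeight y'} := hq
    exact Set.indicator_of_notMem hq' _

/-- `w₁ x = ⨆_{γ ∈ G(F)} H(γ x̃⁻¹)` (★ leaf 1's `supHeight`, re-indexed from `U(J₂)(F)` to `G(F) = arithmeticSubgroup` by ★ `ciSup_borelHeight_toAdelic_mul_eq`). [cite: BernsteinLapid2019, §4 (p. 10)] -/
theorem supHeight_eq_ciSup (x : (quasiSplit F E c 2).automorphicQuotient) :
    supHeight F E c 2 x = ⨆ γ : (quasiSplit F E c 2).arithmeticSubgroup,
      borelHeight ((γ : (quasiSplit F E c 2).Adelic) * (Quotient.out x : (quasiSplit F E c 2).Adelic)⁻¹) := by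
  rw [supHeight]
  exact ciSup_borelHeight_toAdelic_mul_eq _

/-- `w₁ [g] = ⨆_{γ ∈ G(F)} H(γ g⁻¹)` for every `g ∈ 𝔾` (★ `ciSup_borelHeight_mul_out_inv_eq`: `w₁` is `G(F)`-invariant, so the Mathlib representative of `[g]` may be replaced by `g`).
[cite: BernsteinLapid2019, §4 (p. 10)] -/
theorem supHeight_toAutomorphicQuotient (g : (quasiSplit F E c 2).Adelic) :
    supHeight F E c 2 ((quasiSplit F E c 2).toAutomorphicQuotient g) = ⨆ γ : (quasiSplit F E c 2).arithmeticSubgroup, borelHeight ((γ : (quasiSplit F E c 2).Adelic) * g⁻¹) := by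
  rw [supHeight_eq_ciSup]
  exact ciSup_borelHeight_mul_out_inv_eq g

variable [MeasurableSpace (quasiSplit F E c 2).Adelic] [BorelSpace (quasiSplit F E c 2).Adelic]

omit [MeasurableSpace (quasiSplit F E c 2).Adelic] [BorelSpace (quasiSplit F E c 2).Adelic] in
/-- **`w₁` IS LOWER SEMICONTINUOUS**: `{x ∣ a < w₁ x}` is open in `𝔛` — it is the image under the open quotient map `mk : 𝔾 → 𝔛` (Mathlib `QuotientGroup.isOpenMap_coe`) of
`{g ∣ ∃ γ ∈ G(F), a < H(γ g⁻¹)} = ⋃_γ {g ∣ a < H(γ g⁻¹)}`, a union of open sets (`H` continuous ★; `a < ⨆ ⟺ ∃` by ★ `bddAbove_range_borelHeight_mul`). [cite: BernsteinLapid2019, §4 (p. 10)] -/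
theorem isOpen_setOf_lt_supHeight (a : ℝ≥0) : IsOpen {x : (quasiSplit F E c 2).automorphicQuotient | a < supHeight F E c 2 x} := by
  set U : Set (quasiSplit F E c 2).Adelic := {g | ∃ γ : (quasiSplit F E c 2).arithmeticSubgroup, a < borelHeight ((γ : (quasiSplit F E c 2).Adelic) * g⁻¹)} with hU
  have hUo : IsOpen U := by
    have hU' : U = ⋃ γ : (quasiSplit F E c 2).arithmeticSubgroup, {g | a < borelHeight ((γ : (quasiSplit F E c 2).Adelic) * g⁻¹)} := by
      ext g; simp only [hU, Set.mem_setOf_eq, Set.mem_iUnion]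
    rw [hU']
    exact isOpen_iUnion fun γ => isOpen_lt continuous_const (continuous_borelHeight.comp (continuous_const.mul continuous_inv))
  have heq : {x : (quasiSplit F E c 2).automorphicQuotient | a < supHeight F E c 2 x} = (quasiSplit F E c 2).toAutomorphicQuotient '' U := by
    ext x
    constructor
    · intro hx
      refine ⟨(Quotient.out x : (quasiSplit F E c 2).Adelic), ?_, QuotientGroup.out_eq' x⟩
      have hx' : a < ⨆ γ : (quasiSplit F E c 2).arithmeticSubgroup,
          borelHeight ((γ : (quasiSplit F E c 2).Adelic) * (Quotient.out x : (quasiSplit F E c 2).Adelic)⁻¹) := by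
        rw [← supHeight_eq_ciSup]; exact hx
      exact (lt_ciSup_iff (bddAbove_range_borelHeight_mul _)).1 hx'
    · rintro ⟨g, ⟨γ, hγ⟩, rfl⟩
      show a < supHeight F E c 2 ((quasiSplit F E c 2).toAutomorphicQuotient g)
      rw [supHeight_toAutomorphicQuotient]
      exact lt_of_lt_of_le hγ (le_ciSup (bddAbove_range_borelHeight_mul g⁻¹) γ)
  rw [heq]
  exact QuotientGroup.isOpenMap_coe U hUo

omit [MeasurableSpace (quasiSplit F E c 2).Adelic] [BorelSpace (quasiSplit F E c 2).Adelic] in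
/-- **`w₁` is Borel measurable** on `𝔛` (lower semicontinuous, Mathlib `measurable_of_Ioi`) — so the weight `w₁^{−2k}` of `𝓗_k(𝔛)` needs no measurability letter.
[cite: BernsteinLapid2019, §4 (p. 10)] -/
theorem measurable_supHeight : Measurable (supHeight F E c 2) :=
  measurable_of_Ioi fun a => (isOpen_setOf_lt_supHeight a).measurableSet

omit [MeasurableSpace (quasiSplit F E c 2).Adelic] [BorelSpace (quasiSplit F E c 2).Adelic] in
/-- The weight `x ↦ w₁(x)^{−2k}` of `𝓗_k(𝔛)` (★ leaf 1 `HX`) is Borel. [cite: BernsteinLapid2019, §4 (p. 10)] -/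
theorem measurable_supHeight_inv_pow (k : ℕ) :
    Measurable fun x : (quasiSplit F E c 2).automorphicQuotient => (((supHeight F E c 2 x)⁻¹ ^ (2 * k) : ℝ≥0) : ℝ≥0∞) :=
  (measurable_supHeight.inv.pow_const _).coe_nnreal_ennreal

end Generic

/-! ## §4 (CM pair) Two-sided comparison `∫⁻_Z F∘p d(wtm) ≍ ∫⁻_𝔛 F · w₁^{−2k} dμ` and the three letters of `ι` -/

section CM

variable (L : Type) [Field L] [NumberField L] [IsCMField L]
  [MeasurableSpace (quasiSplit (↥(maximalRealSubfield L)) L (IsCMField.complexConj L) 2).Adelic]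
  [BorelSpace (quasiSplit (↥(maximalRealSubfield L)) L (IsCMField.complexConj L) 2).Adelic]

/-- **UPPER COMPARISON** (every `c > 0`): `∃ B ≠ ∞` with `∫⁻_Z F(p z) d(wtm_{k,c} μZ) ≤ B · ∫⁻_𝔛 F(x) · w₁(x)^{−2k} dμ` for all Borel `F ≥ 0` — ★ part 1 unfolding, the fibre series = the
finite fibre sum (§3), and ★ BL-R1 `Σ_{S_c(x̃⁻¹)} H^{−2k} ≤ C'·w₁(x̃⁻¹)^{−2k} = C'·(w₁ x)^{−2k}`; `B = C⁻¹·C'`. [cite: BernsteinLapid2019, §4 Claim 4 (p. 10)] -/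
theorem exists_forall_lintegral_comp_pZX_le_cm
    (μ : Measure (quasiSplit (↥(maximalRealSubfield L)) L (IsCMField.complexConj L) 2).automorphicQuotient)
    [(quasiSplit (↥(maximalRealSubfield L)) L (IsCMField.complexConj L) 2).IsAutomorphicMeasure μ]
    (νG : Measure (quasiSplit (↥(maximalRealSubfield L)) L (IsCMField.complexConj L) 2).Adelic) [νG.IsHaarMeasure] [νG.IsInvInvariant]
    {β : (quasiSplit (↥(maximalRealSubfield L)) L (IsCMField.complexConj L) 2).Adelic → ℝ≥0∞}
    (hβ : IsCoveringWeight ↥((arithmeticBorel (↥(maximalRealSubfield L)) L (IsCMField.complexConj L) 2).map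
      (quasiSplit (↥(maximalRealSubfield L)) L (IsCMField.complexConj L) 2).arithmeticSubgroup.subtype) β)
    {μZ : Measure (borelQuotient (↥(maximalRealSubfield L)) L (IsCMField.complexConj L) 2)}
    (hμZ : ∀ f : borelQuotient (↥(maximalRealSubfield L)) L (IsCMField.complexConj L) 2 → ℝ≥0∞, Measurable f →
      ∫⁻ z, f z ∂μZ = ∫⁻ g, β g * f (toBorelQuotient (↥(maximalRealSubfield L)) L (IsCMField.complexConj L) 2 g) ∂νG)
    {c₀ : ℝ≥0} (hc : 0 < c₀) (k : ℕ) :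
    ∃ B : ℝ≥0∞, B ≠ ⊤ ∧ ∀ Φ : (quasiSplit (↥(maximalRealSubfield L)) L (IsCMField.complexConj L) 2).automorphicQuotient → ℝ≥0∞, Measurable Φ →
      ∫⁻ z, Φ (pZX (↥(maximalRealSubfield L)) L (IsCMField.complexConj L) 2 z)
          ∂(weightedTruncMeasure (↥(maximalRealSubfield L)) L (IsCMField.complexConj L) 2 k c₀ μZ) ≤
        B * ∫⁻ x, Φ x * (((supHeight (↥(maximalRealSubfield L)) L (IsCMField.complexConj L) 2 x)⁻¹ ^ (2 * k) : ℝ≥0) : ℝ≥0∞) ∂μ := by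
  obtain ⟨C, hC0, hCt, hunf⟩ := exists_forall_mul_lintegral_comp_pZX_eq μ νG hβ hμZ
  obtain ⟨C', hC'⟩ := exists_sum_inv_pow_le_mul_ciSup_inv_pow_cm L hc (2 * k)
  refine ⟨C⁻¹ * C', ENNReal.mul_ne_top (ENNReal.inv_ne_top.2 hC0) ENNReal.coe_ne_top, fun Φ hΦ => ?_⟩
  have hkey := hunf k c₀ Φ hΦ
  -- bound the `𝔛`-side integrand
  have hle : ∫⁻ x, Φ x * ∑' q : Quotient (QuotientGroup.rightRel (arithmeticBorel (↥(maximalRealSubfield L)) L (IsCMField.complexConj L) 2)),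
        {y : (quasiSplit (↥(maximalRealSubfield L)) L (IsCMField.complexConj L) 2).Adelic | c₀ < borelHeight y}.indicator
          (fun y => (((borelHeight y)⁻¹ ^ (2 * k) : ℝ≥0) : ℝ≥0∞))
          (((q.out : (quasiSplit (↥(maximalRealSubfield L)) L (IsCMField.complexConj L) 2).arithmeticSubgroup) :
            (quasiSplit (↥(maximalRealSubfield L)) L (IsCMField.complexConj L) 2).Adelic) *
            (Quotient.out x : (quasiSplit (↥(maximalRealSubfield L)) L (IsCMField.complexConj L) 2).Adelic)⁻¹) ∂μ ≤
      ∫⁻ x, Φ x * ((C' : ℝ≥0∞) * (((supHeight (↥(maximalRealSubfield L)) L (IsCMField.complexConj L) 2 x)⁻¹ ^ (2 * k) : ℝ≥0) : ℝ≥0∞)) ∂μ := by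
    refine lintegral_mono fun x => ?_
    rw [tsum_truncWeight_eq_coe_sum hc k, supHeight_eq_ciSup, ← ENNReal.coe_mul]
    gcongr
    exact hC' _
  -- divide by `C`
  have hint : ∫⁻ z, Φ (pZX (↥(maximalRealSubfield L)) L (IsCMField.complexConj L) 2 z)
        ∂(weightedTruncMeasure (↥(maximalRealSubfield L)) L (IsCMField.complexConj L) 2 k c₀ μZ) =
      C⁻¹ * (C * ∫⁻ z, Φ (pZX (↥(maximalRealSubfield L)) L (IsCMField.complexConj L) 2 z)
        ∂(weightedTruncMeasure (↥(maximalRealSubfield L)) L (IsCMField.complexConj L) 2 k c₀ μZ)) := by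
    rw [← mul_assoc, ENNReal.inv_mul_cancel hC0 hCt, one_mul]
  rw [hint, hkey, mul_assoc]
  gcongr
  refine hle.trans (le_of_eq ?_)
  rw [← lintegral_const_mul' _ _ ENNReal.coe_ne_top]
  refine lintegral_congr fun x => ?_
  ring

/-- **LOWER COMPARISON** (for `0 < c < c₁`, `c₁ > 0` the ★ covering constant): `∃ A ≠ 0, ∞` with `A · ∫⁻_𝔛 F · w₁^{−2k} dμ ≤ ∫⁻_Z F∘p d(wtm_{k,c})` for all Borel `F ≥ 0` — the maximiser
coset `B(F)γ₀`, `H(γ₀ x̃⁻¹) = w₁(x) > c₁ > c`, contributes `w₁(x)^{−2k}` to the fibre sum (★ `exists_pos_forall_ciSup_inv_pow_le_sum_le_cm`); `A = C⁻¹`.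
[cite: BernsteinLapid2019, §4 Claim 4 (p. 10)] -/
theorem exists_pos_forall_mul_lintegral_le_lintegral_comp_pZX_cm
    (μ : Measure (quasiSplit (↥(maximalRealSubfield L)) L (IsCMField.complexConj L) 2).automorphicQuotient)
    [(quasiSplit (↥(maximalRealSubfield L)) L (IsCMField.complexConj L) 2).IsAutomorphicMeasure μ]
    (νG : Measure (quasiSplit (↥(maximalRealSubfield L)) L (IsCMField.complexConj L) 2).Adelic) [νG.IsHaarMeasure] [νG.IsInvInvariant]
    {β : (quasiSplit (↥(maximalRealSubfield L)) L (IsCMField.complexConj L) 2).Adelic → ℝ≥0∞}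
    (hβ : IsCoveringWeight ↥((arithmeticBorel (↥(maximalRealSubfield L)) L (IsCMField.complexConj L) 2).map
      (quasiSplit (↥(maximalRealSubfield L)) L (IsCMField.complexConj L) 2).arithmeticSubgroup.subtype) β)
    {μZ : Measure (borelQuotient (↥(maximalRealSubfield L)) L (IsCMField.complexConj L) 2)}
    (hμZ : ∀ f : borelQuotient (↥(maximalRealSubfield L)) L (IsCMField.complexConj L) 2 → ℝ≥0∞, Measurable f →
      ∫⁻ z, f z ∂μZ = ∫⁻ g, β g * f (toBorelQuotient (↥(maximalRealSubfield L)) L (IsCMField.complexConj L) 2 g) ∂νG)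
    (k : ℕ) :
    ∃ c₁ : ℝ≥0, 0 < c₁ ∧ ∀ c₀ : ℝ≥0, 0 < c₀ → c₀ < c₁ → ∃ A : ℝ≥0∞, A ≠ 0 ∧ A ≠ ⊤ ∧
      ∀ Φ : (quasiSplit (↥(maximalRealSubfield L)) L (IsCMField.complexConj L) 2).automorphicQuotient → ℝ≥0∞, Measurable Φ →
        A * ∫⁻ x, Φ x * (((supHeight (↥(maximalRealSubfield L)) L (IsCMField.complexConj L) 2 x)⁻¹ ^ (2 * k) : ℝ≥0) : ℝ≥0∞) ∂μ ≤
          ∫⁻ z, Φ (pZX (↥(maximalRealSubfield L)) L (IsCMField.complexConj L) 2 z)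
            ∂(weightedTruncMeasure (↥(maximalRealSubfield L)) L (IsCMField.complexConj L) 2 k c₀ μZ) := by
  obtain ⟨C, hC0, hCt, hunf⟩ := exists_forall_mul_lintegral_comp_pZX_eq μ νG hβ hμZ
  obtain ⟨c₁, hc₁, hlow⟩ := exists_pos_forall_ciSup_inv_pow_le_sum_le_cm L (2 * k)
  refine ⟨c₁, hc₁, fun c₀ hc hlt => ⟨C⁻¹, ENNReal.inv_ne_zero.2 hCt, ENNReal.inv_ne_top.2 hC0, fun Φ hΦ => ?_⟩⟩
  obtain ⟨C', hC'⟩ := hlow c₀ hc hlt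
  have hkey := hunf k c₀ Φ hΦ
  have hle : ∫⁻ x, Φ x * (((supHeight (↥(maximalRealSubfield L)) L (IsCMField.complexConj L) 2 x)⁻¹ ^ (2 * k) : ℝ≥0) : ℝ≥0∞) ∂μ ≤
      ∫⁻ x, Φ x * ∑' q : Quotient (QuotientGroup.rightRel (arithmeticBorel (↥(maximalRealSubfield L)) L (IsCMField.complexConj L) 2)),
        {y : (quasiSplit (↥(maximalRealSubfield L)) L (IsCMField.complexConj L) 2).Adelic | c₀ < borelHeight y}.indicator
          (fun y => (((borelHeight y)⁻¹ ^ (2 * k) : ℝ≥0) : ℝ≥0∞))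
          (((q.out : (quasiSplit (↥(maximalRealSubfield L)) L (IsCMField.complexConj L) 2).arithmeticSubgroup) :
            (quasiSplit (↥(maximalRealSubfield L)) L (IsCMField.complexConj L) 2).Adelic) *
            (Quotient.out x : (quasiSplit (↥(maximalRealSubfield L)) L (IsCMField.complexConj L) 2).Adelic)⁻¹) ∂μ := by
    refine lintegral_mono fun x => ?_
    rw [tsum_truncWeight_eq_coe_sum hc k, supHeight_eq_ciSup]
    gcongr
    exact (hC' (Quotient.out x : (quasiSplit (↥(maximalRealSubfield L)) L (IsCMField.complexConj L) 2).Adelic)⁻¹).1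
  calc C⁻¹ * ∫⁻ x, Φ x * (((supHeight (↥(maximalRealSubfield L)) L (IsCMField.complexConj L) 2 x)⁻¹ ^ (2 * k) : ℝ≥0) : ℝ≥0∞) ∂μ
      ≤ C⁻¹ * (C * ∫⁻ z, Φ (pZX (↥(maximalRealSubfield L)) L (IsCMField.complexConj L) 2 z)
          ∂(weightedTruncMeasure (↥(maximalRealSubfield L)) L (IsCMField.complexConj L) 2 k c₀ μZ)) := by
        rw [hkey]; gcongr
    _ = _ := by rw [← mul_assoc, ENNReal.inv_mul_cancel hC0 hCt, one_mul]

/-- **LETTER (i) OF `IotaBound`: `p` IS QUASI-MEASURE-PRESERVING** from `(Z, wtm_{k,c} μZ)` to `(𝔛, μ.withDensity w₁^{−2k})` (every `c > 0`): a `μ.withDensity w₁^{−2k}`-null Borel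
set `A` has `wtm(p⁻¹ A) = ∫⁻_Z 𝟙_A∘p d(wtm) ≤ B · ∫⁻_A w₁^{−2k} dμ = 0`. [cite: BernsteinLapid2019, §4 Claim 4 (p. 10)] -/
theorem quasiMeasurePreserving_pZX_cm
    (μ : Measure (quasiSplit (↥(maximalRealSubfield L)) L (IsCMField.complexConj L) 2).automorphicQuotient)
    [(quasiSplit (↥(maximalRealSubfield L)) L (IsCMField.complexConj L) 2).IsAutomorphicMeasure μ]
    (νG : Measure (quasiSplit (↥(maximalRealSubfield L)) L (IsCMField.complexConj L) 2).Adelic) [νG.IsHaarMeasure] [νG.IsInvInvariant]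
    {β : (quasiSplit (↥(maximalRealSubfield L)) L (IsCMField.complexConj L) 2).Adelic → ℝ≥0∞}
    (hβ : IsCoveringWeight ↥((arithmeticBorel (↥(maximalRealSubfield L)) L (IsCMField.complexConj L) 2).map
      (quasiSplit (↥(maximalRealSubfield L)) L (IsCMField.complexConj L) 2).arithmeticSubgroup.subtype) β)
    {μZ : Measure (borelQuotient (↥(maximalRealSubfield L)) L (IsCMField.complexConj L) 2)}
    (hμZ : ∀ f : borelQuotient (↥(maximalRealSubfield L)) L (IsCMField.complexConj L) 2 → ℝ≥0∞, Measurable f →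
      ∫⁻ z, f z ∂μZ = ∫⁻ g, β g * f (toBorelQuotient (↥(maximalRealSubfield L)) L (IsCMField.complexConj L) 2 g) ∂νG)
    {c₀ : ℝ≥0} (hc : 0 < c₀) (k : ℕ) :
    QuasiMeasurePreserving (pZX (↥(maximalRealSubfield L)) L (IsCMField.complexConj L) 2)
      (weightedTruncMeasure (↥(maximalRealSubfield L)) L (IsCMField.complexConj L) 2 k c₀ μZ)
      (μ.withDensity fun x => (((supHeight (↥(maximalRealSubfield L)) L (IsCMField.complexConj L) 2 x)⁻¹ ^ (2 * k) : ℝ≥0) : ℝ≥0∞)) := by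
  obtain ⟨B, hBt, hB⟩ := exists_forall_lintegral_comp_pZX_le_cm L μ νG hβ hμZ hc k
  refine ⟨measurable_pZX, Measure.AbsolutelyContinuous.mk fun A hA h0 => ?_⟩
  rw [Measure.map_apply measurable_pZX hA]
  have h1 : weightedTruncMeasure (↥(maximalRealSubfield L)) L (IsCMField.complexConj L) 2 k c₀ μZ
        (pZX (↥(maximalRealSubfield L)) L (IsCMField.complexConj L) 2 ⁻¹' A) =
      ∫⁻ z, A.indicator 1 (pZX (↥(maximalRealSubfield L)) L (IsCMField.complexConj L) 2 z)
        ∂(weightedTruncMeasure (↥(maximalRealSubfield L)) L (IsCMField.complexConj L) 2 k c₀ μZ) := by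
    rw [← lintegral_indicator_one (measurable_pZX hA)]
    rfl
  have h2 := hB (A.indicator 1) (measurable_one.indicator hA)
  have h3 : ∫⁻ x, A.indicator 1 x * (((supHeight (↥(maximalRealSubfield L)) L (IsCMField.complexConj L) 2 x)⁻¹ ^ (2 * k) : ℝ≥0) : ℝ≥0∞) ∂μ =
      (μ.withDensity fun x => (((supHeight (↥(maximalRealSubfield L)) L (IsCMField.complexConj L) 2 x)⁻¹ ^ (2 * k) : ℝ≥0) : ℝ≥0∞)) A := by
    rw [withDensity_apply _ hA, ← lintegral_indicator hA]
    refine lintegral_congr fun x => ?_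
    by_cases hx : x ∈ A
    · rw [Set.indicator_of_mem hx, Set.indicator_of_mem hx, Pi.one_apply, one_mul]
    · rw [Set.indicator_of_notMem hx, Set.indicator_of_notMem hx, zero_mul]
  rw [h1]
  refine le_antisymm ?_ bot_le
  calc _ ≤ B * ∫⁻ x, A.indicator 1 x * (((supHeight (↥(maximalRealSubfield L)) L (IsCMField.complexConj L) 2 x)⁻¹ ^ (2 * k) : ℝ≥0) : ℝ≥0∞) ∂μ := h2
    _ = 0 := by rw [h3, h0, mul_zero]

/-- **LETTER (ii) OF `IotaBound`: THE PULL-BACK IS BOUNDED** (every `c > 0`): `∃ C` with `‖u ∘ p‖_{L²(wtm_{k,c})} ≤ C · ‖u‖_{L²(μ.withDensity w₁^{−2k})}` for every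
`u ∈ 𝓗_k(𝔛) = HX k μ` — ★ leaf 2's `IotaBound` (ii) with `iotaFun u = u ∘ pZX` unfolded; via a Borel representative `ũ` of `u` (transported to `Z` by letter (i)),
`‖·‖_{L²}² = ∫⁻ ‖·‖ₑ²`, and the upper comparison at `F = ‖ũ‖ₑ²`; `C = √B`. [cite: BernsteinLapid2019, §4 Claim 4 (p. 10)] -/
theorem exists_eLpNorm_comp_pZX_le_cm
    (μ : Measure (quasiSplit (↥(maximalRealSubfield L)) L (IsCMField.complexConj L) 2).automorphicQuotient)
    [(quasiSplit (↥(maximalRealSubfield L)) L (IsCMField.complexConj L) 2).IsAutomorphicMeasure μ]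
    (νG : Measure (quasiSplit (↥(maximalRealSubfield L)) L (IsCMField.complexConj L) 2).Adelic) [νG.IsHaarMeasure] [νG.IsInvInvariant]
    {β : (quasiSplit (↥(maximalRealSubfield L)) L (IsCMField.complexConj L) 2).Adelic → ℝ≥0∞}
    (hβ : IsCoveringWeight ↥((arithmeticBorel (↥(maximalRealSubfield L)) L (IsCMField.complexConj L) 2).map
      (quasiSplit (↥(maximalRealSubfield L)) L (IsCMField.complexConj L) 2).arithmeticSubgroup.subtype) β)
    {μZ : Measure (borelQuotient (↥(maximalRealSubfield L)) L (IsCMField.complexConj L) 2)}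
    (hμZ : ∀ f : borelQuotient (↥(maximalRealSubfield L)) L (IsCMField.complexConj L) 2 → ℝ≥0∞, Measurable f →
      ∫⁻ z, f z ∂μZ = ∫⁻ g, β g * f (toBorelQuotient (↥(maximalRealSubfield L)) L (IsCMField.complexConj L) 2 g) ∂νG)
    {c₀ : ℝ≥0} (hc : 0 < c₀) (k : ℕ) :
    ∃ C : ℝ≥0, ∀ u : HX (↥(maximalRealSubfield L)) L (IsCMField.complexConj L) 2 k μ,
      eLpNorm (fun z => (u : (quasiSplit (↥(maximalRealSubfield L)) L (IsCMField.complexConj L) 2).automorphicQuotient → ℂ)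
          (pZX (↥(maximalRealSubfield L)) L (IsCMField.complexConj L) 2 z)) 2
        (weightedTruncMeasure (↥(maximalRealSubfield L)) L (IsCMField.complexConj L) 2 k c₀ μZ) ≤
      C * eLpNorm (u : (quasiSplit (↥(maximalRealSubfield L)) L (IsCMField.complexConj L) 2).automorphicQuotient → ℂ) 2
        (μ.withDensity fun x => (((supHeight (↥(maximalRealSubfield L)) L (IsCMField.complexConj L) 2 x)⁻¹ ^ (2 * k) : ℝ≥0) : ℝ≥0∞)) := by
  obtain ⟨B, hBt, hB⟩ := exists_forall_lintegral_comp_pZX_le_cm L μ νG hβ hμZ hc k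
  have hqmp := quasiMeasurePreserving_pZX_cm L μ νG hβ hμZ hc k
  set w : (quasiSplit (↥(maximalRealSubfield L)) L (IsCMField.complexConj L) 2).automorphicQuotient → ℝ≥0∞ :=
    fun x => (((supHeight (↥(maximalRealSubfield L)) L (IsCMField.complexConj L) 2 x)⁻¹ ^ (2 * k) : ℝ≥0) : ℝ≥0∞) with hw
  have hwm : Measurable w := measurable_supHeight_inv_pow k
  refine ⟨(B ^ (1 / 2 : ℝ)).toNNReal, fun u => ?_⟩
  -- a Borel representative `ũ` of `u`
  have hu : AEStronglyMeasurable (u : _ → ℂ) (μ.withDensity w) := (Lp.memLp u).aestronglyMeasurable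
  set ũ := hu.mk (u : _ → ℂ) with hũ
  have hũm : Measurable ũ := hu.stronglyMeasurable_mk.measurable
  have hae : (u : _ → ℂ) =ᵐ[μ.withDensity w] ũ := hu.ae_eq_mk
  have haeZ : (fun z => (u : _ → ℂ) (pZX (↥(maximalRealSubfield L)) L (IsCMField.complexConj L) 2 z)) =ᵐ[weightedTruncMeasure (↥(maximalRealSubfield L)) L (IsCMField.complexConj L) 2 k c₀ μZ]
      (fun z => ũ (pZX (↥(maximalRealSubfield L)) L (IsCMField.complexConj L) 2 z)) := hqmp.ae_eq hae
  rw [eLpNorm_congr_ae haeZ, eLpNorm_congr_ae hae]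
  -- `L²` norms as lintegrals
  have h2 : (2 : ℝ≥0∞) ≠ 0 := two_ne_zero
  have h2' : (2 : ℝ≥0∞) ≠ ⊤ := ENNReal.ofNat_ne_top
  rw [eLpNorm_eq_lintegral_rpow_enorm_toReal h2 h2', eLpNorm_eq_lintegral_rpow_enorm_toReal h2 h2', ENNReal.toReal_ofNat]
  have hΦm : Measurable fun x => ‖ũ x‖ₑ ^ (2 : ℝ) := hũm.enorm.pow_const _
  have hcomp := hB (fun x => ‖ũ x‖ₑ ^ (2 : ℝ)) hΦm
  have hX : ∫⁻ x, ‖ũ x‖ₑ ^ (2 : ℝ) ∂(μ.withDensity w) = ∫⁻ x, ‖ũ x‖ₑ ^ (2 : ℝ) * w x ∂μ := by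
    rw [lintegral_withDensity_eq_lintegral_mul _ hwm hΦm]
    exact lintegral_congr fun x => mul_comm _ _
  rw [hX]
  calc (∫⁻ z, ‖ũ (pZX (↥(maximalRealSubfield L)) L (IsCMField.complexConj L) 2 z)‖ₑ ^ (2 : ℝ)
          ∂(weightedTruncMeasure (↥(maximalRealSubfield L)) L (IsCMField.complexConj L) 2 k c₀ μZ)) ^ (1 / (2 : ℝ))
      ≤ (B * ∫⁻ x, ‖ũ x‖ₑ ^ (2 : ℝ) * w x ∂μ) ^ (1 / (2 : ℝ)) := by gcongr
    _ = B ^ (1 / (2 : ℝ)) * (∫⁻ x, ‖ũ x‖ₑ ^ (2 : ℝ) * w x ∂μ) ^ (1 / (2 : ℝ)) := ENNReal.mul_rpow_of_nonneg _ _ (by norm_num)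
    _ = ((B ^ (1 / 2 : ℝ)).toNNReal : ℝ≥0∞) * (∫⁻ x, ‖ũ x‖ₑ ^ (2 : ℝ) * w x ∂μ) ^ (1 / (2 : ℝ)) := by
        rw [ENNReal.coe_toNNReal (ENNReal.rpow_ne_top_of_nonneg (by norm_num) hBt)]

/-- **`ι` IS BOUNDED BELOW** (for `0 < c < c₁`): `∃ κ > 0` with `κ · ‖u‖_{L²(μ.withDensity w₁^{−2k})} ≤ ‖u ∘ p‖_{L²(wtm_{k,c})}` for every `u ∈ 𝓗_k(𝔛)` — hence `ι_{c,k}` is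
injective with closed range (the `(hinj)(hcl)` letters of ★ leaf 2's `piN`; Mathlib `AntilipschitzWith.isClosed_range`); `κ = √A`. [cite: BernsteinLapid2019, §4 Claim 4 (p. 10)] -/
theorem exists_pos_forall_mul_eLpNorm_le_eLpNorm_comp_pZX_cm
    (μ : Measure (quasiSplit (↥(maximalRealSubfield L)) L (IsCMField.complexConj L) 2).automorphicQuotient)
    [(quasiSplit (↥(maximalRealSubfield L)) L (IsCMField.complexConj L) 2).IsAutomorphicMeasure μ]
    (νG : Measure (quasiSplit (↥(maximalRealSubfield L)) L (IsCMField.complexConj L) 2).Adelic) [νG.IsHaarMeasure] [νG.IsInvInvariant]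
    {β : (quasiSplit (↥(maximalRealSubfield L)) L (IsCMField.complexConj L) 2).Adelic → ℝ≥0∞}
    (hβ : IsCoveringWeight ↥((arithmeticBorel (↥(maximalRealSubfield L)) L (IsCMField.complexConj L) 2).map
      (quasiSplit (↥(maximalRealSubfield L)) L (IsCMField.complexConj L) 2).arithmeticSubgroup.subtype) β)
    {μZ : Measure (borelQuotient (↥(maximalRealSubfield L)) L (IsCMField.complexConj L) 2)}
    (hμZ : ∀ f : borelQuotient (↥(maximalRealSubfield L)) L (IsCMField.complexConj L) 2 → ℝ≥0∞, Measurable f →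
      ∫⁻ z, f z ∂μZ = ∫⁻ g, β g * f (toBorelQuotient (↥(maximalRealSubfield L)) L (IsCMField.complexConj L) 2 g) ∂νG)
    (k : ℕ) :
    ∃ c₁ : ℝ≥0, 0 < c₁ ∧ ∀ c₀ : ℝ≥0, 0 < c₀ → c₀ < c₁ → ∃ κ : ℝ≥0, 0 < κ ∧
      ∀ u : HX (↥(maximalRealSubfield L)) L (IsCMField.complexConj L) 2 k μ,
        κ * eLpNorm (u : (quasiSplit (↥(maximalRealSubfield L)) L (IsCMField.complexConj L) 2).automorphicQuotient → ℂ) 2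
            (μ.withDensity fun x => (((supHeight (↥(maximalRealSubfield L)) L (IsCMField.complexConj L) 2 x)⁻¹ ^ (2 * k) : ℝ≥0) : ℝ≥0∞)) ≤
          eLpNorm (fun z => (u : (quasiSplit (↥(maximalRealSubfield L)) L (IsCMField.complexConj L) 2).automorphicQuotient → ℂ)
              (pZX (↥(maximalRealSubfield L)) L (IsCMField.complexConj L) 2 z)) 2
            (weightedTruncMeasure (↥(maximalRealSubfield L)) L (IsCMField.complexConj L) 2 k c₀ μZ) := by
  obtain ⟨c₁, hc₁, hlow⟩ := exists_pos_forall_mul_lintegral_le_lintegral_comp_pZX_cm L μ νG hβ hμZ k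
  refine ⟨c₁, hc₁, fun c₀ hc hlt => ?_⟩
  obtain ⟨A, hA0, hAt, hA⟩ := hlow c₀ hc hlt
  have hqmp := quasiMeasurePreserving_pZX_cm L μ νG hβ hμZ hc k
  set w : (quasiSplit (↥(maximalRealSubfield L)) L (IsCMField.complexConj L) 2).automorphicQuotient → ℝ≥0∞ :=
    fun x => (((supHeight (↥(maximalRealSubfield L)) L (IsCMField.complexConj L) 2 x)⁻¹ ^ (2 * k) : ℝ≥0) : ℝ≥0∞) with hw
  have hwm : Measurable w := measurable_supHeight_inv_pow k
  have hκpos : 0 < (A ^ (1 / 2 : ℝ)).toNNReal :=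
    ENNReal.toNNReal_pos (ENNReal.rpow_pos (pos_iff_ne_zero.2 hA0) hAt).ne' (ENNReal.rpow_ne_top_of_nonneg (by norm_num) hAt)
  refine ⟨(A ^ (1 / 2 : ℝ)).toNNReal, hκpos, fun u => ?_⟩
  have hu : AEStronglyMeasurable (u : _ → ℂ) (μ.withDensity w) := (Lp.memLp u).aestronglyMeasurable
  set ũ := hu.mk (u : _ → ℂ) with hũ
  have hũm : Measurable ũ := hu.stronglyMeasurable_mk.measurable
  have hae : (u : _ → ℂ) =ᵐ[μ.withDensity w] ũ := hu.ae_eq_mk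
  have haeZ : (fun z => (u : _ → ℂ) (pZX (↥(maximalRealSubfield L)) L (IsCMField.complexConj L) 2 z)) =ᵐ[weightedTruncMeasure (↥(maximalRealSubfield L)) L (IsCMField.complexConj L) 2 k c₀ μZ]
      (fun z => ũ (pZX (↥(maximalRealSubfield L)) L (IsCMField.complexConj L) 2 z)) := hqmp.ae_eq hae
  rw [eLpNorm_congr_ae haeZ, eLpNorm_congr_ae hae]
  have h2 : (2 : ℝ≥0∞) ≠ 0 := two_ne_zero
  have h2' : (2 : ℝ≥0∞) ≠ ⊤ := ENNReal.ofNat_ne_top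
  rw [eLpNorm_eq_lintegral_rpow_enorm_toReal h2 h2', eLpNorm_eq_lintegral_rpow_enorm_toReal h2 h2', ENNReal.toReal_ofNat]
  have hΦm : Measurable fun x => ‖ũ x‖ₑ ^ (2 : ℝ) := hũm.enorm.pow_const _
  have hcomp := hA (fun x => ‖ũ x‖ₑ ^ (2 : ℝ)) hΦm
  have hX : ∫⁻ x, ‖ũ x‖ₑ ^ (2 : ℝ) ∂(μ.withDensity w) = ∫⁻ x, ‖ũ x‖ₑ ^ (2 : ℝ) * w x ∂μ := by
    rw [lintegral_withDensity_eq_lintegral_mul _ hwm hΦm]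
    exact lintegral_congr fun x => mul_comm _ _
  rw [hX, ENNReal.coe_toNNReal (ENNReal.rpow_ne_top_of_nonneg (by norm_num) hAt), ← ENNReal.mul_rpow_of_nonneg _ _ (by norm_num)]
  gcongr

end CM

end Summit.HodgeConjecture.HodgeConjecture.Cruxes.H413.K2E1BLIotaBoundU2

end
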